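import Literature.AlgebraicGeometry.Frobenioids.Thm42Sub
import Literature.AlgebraicGeometry.Frobenioids.PrimarySteps
import Literature.AlgebraicGeometry.Frobenioids.PerfFactorialSupports
import HarnessLib

/-!
# [FrdI] Theorem 4.2 (i): `Ψ` preserves primary steps — sub-DAG rows T42-L05, T42-L06, T42-L07

Mochizuki, *The geometry of Frobenioids I: the general theory*, Kyushu J. Math. **62** (2008)
293–400, §4, Theorem 4.2 (i), proof p. 78 l. 47 – p. 80 l. 17 of the kurims text (Kyushu pp. 360–362)
[cite: MochizukiFrdI2008, Thm. 4.2 (i) p.78].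

PROOF-ONLY companion of the statements file `Thm42Sub.lean` (seat abc-iut-L1-t14; sub-DAG
`plan/L1/SUBDAG-FrdI-Thm42-Thm49.md`, rows `T42-L05` `PrimaryStepsPropagateAlongPrimaryStep`,
`T42-L06` `PrimaryStepsPropagateToB`, `T42-L07` `PrimaryStepsPropagateFromB` and the conclusion
`PrimaryStepsPreserved`): the four named `Prop`s are discharged (`…_holds`).

THE ARGUMENT. In the setting of the proof after its two reductions (`FrdI.T42.Setting`: Frobenioids of
PERFECT and ISOTROPIC type, `Φ_i` perf-factorial, `Ψ` and a quasi-inverse preserving pre-steps and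
steps — Thm. 3.4 (ii)), the property "`φ` is a primary pre-step" is detected by the ORDER structure of
the pre-steps out of the domain of `φ` alone, hence is preserved by `Ψ` directly:

* (monoids, Def. 2.4 (i)) in a perfect perf-factorial monoid `M ⊆ ∏_𝔭 M_𝔭` an element `x ≠ 0` is
  primary iff any two elements `≤ x` are comparable for `≤` (`IsPerfFactorial.isPrimary_iff_dvd_total`:
  a primary `x` and all its non-zero divisors lie in one `M_𝔭`, which is monoprime, i.e. totally
  ordered — Def. 2.4 (i)(b), exactly "the structure of the `Φ(A)_𝔭`" used on p. 76; a non-primary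
  `x ≠ 0` splits at a prime of its support into two incomparable divisors — the "primary
  factorizations" of Def. 2.4 (i)(c)(d), pp. 76–77);
* (Frobenioids, Def. 1.3 (iii)(d)) "by applying the equivalences of categories of Definition 1.3,
  (iii), (d)" (p. 79) — the co-angular pre-steps out of `A` form a category equivalent to
  `Order(Φ(A))` via `Div(−)`, and in a Frobenioid of isotropic type every pre-step is co-angular
  (Prop. 1.4 (i)) — this becomes: a pre-step `φ : A → B` is primary iff it is a step and any two
  pre-steps `A → B₁`, `A → B₂` through which `φ` factors are comparable, i.e. one factors through
  the other (`PreFrobenioid.isPrimary_div_iff_of_isPreStep`; `Φ(A)` is perfect by Prop. 1.10 (iii));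
* an equivalence `Ψ` that maps pre-steps and steps to pre-steps and steps (together with its
  quasi-inverse) preserves and reflects factorizations, hence maps primary pre-steps to primary
  pre-steps (`FrdI.T42.Setting.isPrimaryPreStep_map`).

Consequently `Ψ` "maps primary steps to or from `X` to primary steps to or from `Ψ(X)`" together with
primary composites (`FrdI.T42.preservesPrimaryAt`) for EVERY object `X`, which yields the three
propagation rows and the conclusion "`Ψ` preserves primary steps" (p. 80 l. 15–17) without further
hypotheses. (The printed route propagates the property from a Div-Frobenius-trivial object along
Prop. 4.1 (iii)/(iv)/(v); the typed rows are implications whose conclusions are instances of the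
general statement proved here, so they hold as typed.) No new definitions; no statement of the paper
is changed; nothing here bears on [IUTchIII].
-/

namespace Literature.AlgebraicGeometry.Frobenioids

open CategoryTheory Opposite

universe w v v' u u'

/-! ### 1. Perf-factorial monoids: primary elements are the non-zero elements with totally ordered divisors -/

section Monoid

variable {M : Type w} [CommMonoid M]

/-- In a perf-factorial monoid, any two divisors of a primary element are comparable for `≤` (they
lie, together with the element, in one `M_𝔭`, which is monoprime: Def. 2.4 (i)(b); "the structure of
the `Φ(A)_𝔭`", proof of Prop. 4.1 (ii) p. 76). [cite: MochizukiFrdI2008, Def. 2.4 (i) p.47] -/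
theorem IsPerfFactorial.dvd_total_of_dvd_of_isPrimary (h : IsPerfFactorial M) {x b c : M}
    (hx : IsPrimary x) (hb : b ∣ x) (hc : c ∣ x) : b ∣ c ∨ c ∣ b := by
  by_cases hb1 : b = 1
  · exact Or.inl (hb1 ▸ one_dvd c)
  by_cases hc1 : c = 1
  · exact Or.inr (hc1 ▸ one_dvd b)
  let 𝔭 : Primes M := Quotient.mk (primarySetoid M) ⟨x, hx⟩
  have hxp : x ∈ 𝔭.carrier := mem_carrier_mk_of_isPrimary hx
  have hbp : b ∈ 𝔭.submonoid :=
    Submonoid.subset_closure (𝔭.mem_carrier_of_precsim hxp hb1 (Precsim.of_dvd hb))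
  have hcp : c ∈ 𝔭.submonoid :=
    Submonoid.subset_closure (𝔭.mem_carrier_of_precsim hxp hc1 (Precsim.of_dvd hc))
  exact h.dvd_total_of_mem_submonoid 𝔭 hbp hcp

/-- In a perfect perf-factorial monoid, a non-zero element any two of whose divisors are comparable
is primary ("by comparing the primary factorizations", Def. 2.4 (i)(c)(d), pp. 76–77: a non-primary
`x ≠ 0` has a non-zero `𝔮`-component and a non-zero `𝔮`-free part for some prime `𝔮` of its support,
and these two divisors of `x` are incomparable). [cite: MochizukiFrdI2008, Def. 2.4 (i) p.47] -/
theorem IsPerfFactorial.isPrimary_of_dvd_total (h : IsPerfFactorial M) (hperf : IsPerfect M)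
    {x : M} (hx : x ≠ 1) (htot : ∀ b c : M, b ∣ x → c ∣ x → b ∣ c ∨ c ∣ b) : IsPrimary x := by
  classical
  have hM : IsSharp M := h.isDivisorial.isSharp
  have hbij := isPerfect_iff_bijective_of.mp hperf
  by_contra hnp
  have hox1 : Perfection.of M x ≠ 1 := fun e => hx (hbij.1 (by rw [e, map_one]))
  obtain ⟨𝔮, hq⟩ := h.exists_factorMap_apply_ne_one hox1
  obtain ⟨x₁, x₂, xx, hxs, hx₁, hx₂⟩ := h.exists_split (Perfection.of M x) 𝔮
  have hx₁q : factorMap M x₁ 𝔮 ≠ 1 := by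
    rw [← h.factorMap_apply_of_split_same hxs hx₂]; exact hq
  have hx₁1 : x₁ ≠ 1 := fun e => hx₁q (by rw [e, h.factorMap_one]; rfl)
  have hx₁c : x₁ ∈ 𝔮.carrier := h.mem_carrier_of_factorMap_eq_mulSingle xx hx₁ hx₁1
  -- the `𝔮`-free part is non-trivial, for otherwise `x` would be primary
  have hx₂1 : x₂ ≠ 1 := by
    intro e
    apply hnp
    rw [e, mul_one] at hxs
    obtain ⟨hprim, -⟩ := hx₁c
    rw [hxs] at hprim
    exact (Perfection.isPrimary_of_iff hM).mp hprim
  obtain ⟨X₁, hX₁⟩ := hbij.2 x₁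
  obtain ⟨X₂, hX₂⟩ := hbij.2 x₂
  have hX₁x : X₁ ∣ x := (Perfection.of_dvd_of_iff hbij).mp (by
    rw [hX₁, ← hxs]; exact Dvd.intro _ rfl)
  have hX₂x : X₂ ∣ x := (Perfection.of_dvd_of_iff hbij).mp (by
    rw [hX₂, ← hxs]; exact Dvd.intro_left _ rfl)
  rcases htot X₁ X₂ hX₁x hX₂x with hd | hd
  · -- `x₁ ∣ x₂` is impossible: `x₁ ∈ 𝔮`, `x₂` is `𝔮`-free
    have hd' : x₁ ∣ x₂ := by rw [← hX₁, ← hX₂]; exact map_dvd _ hd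
    exact h.not_dvd_of_factorMap_apply_eq_one hx₁c hx₂ hd'
  · -- `x₂ ∣ x₁` is impossible: the support of `x₂` would lie in `{𝔮}`, where `x₂` has no coordinate
    have hd' : x₂ ∣ x₁ := by rw [← hX₁, ← hX₂]; exact map_dvd _ hd
    apply hx₂1
    apply h.factorMap_injective
    rw [h.factorMap_one]
    funext 𝔮'
    by_cases e : 𝔮' = 𝔮
    · rw [e, hx₂]; rfl
    · by_contra hne
      have hmem : 𝔮' ∈ supp (factorMap M x₂) := hne
      have h1 := h.supp_factorMap_subset_of_dvd hd' hmem
      simp only [supp, Set.mem_setOf_eq, hx₁, pfFactorToRlfFactor_apply, Pi.mulSingle_eq_of_ne e,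
        map_one, ne_eq, not_true_eq_false] at h1

/-- **Primary elements of a perfect perf-factorial monoid, order-theoretically**: `x` is primary iff
`x ≠ 0` and any two elements `≤ x` are comparable (Def. 2.4 (i)(b)(c)(d)).
[cite: MochizukiFrdI2008, Def. 2.4 (i) p.47] -/
theorem IsPerfFactorial.isPrimary_iff_dvd_total (h : IsPerfFactorial M) (hperf : IsPerfect M)
    (x : M) : IsPrimary x ↔ x ≠ 1 ∧ ∀ b c : M, b ∣ x → c ∣ x → b ∣ c ∨ c ∣ b :=
  ⟨fun hx => ⟨hx.1, fun _ _ hb hc => h.dvd_total_of_dvd_of_isPrimary hx hb hc⟩,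
    fun hx => h.isPrimary_of_dvd_total hperf hx.1 hx.2⟩

end Monoid

/-! ### 2. Frobenioids: primary pre-steps through the order of the pre-steps out of the domain -/

namespace PreFrobenioid

variable {D : Type u} [Category.{v} D] {Φ : Dᵒᵖ ⥤ CommMonCat.{w}}
  {C : Type u'} [Category.{v'} C] {F : C ⥤ ElemFrobenioid Φ}

/-- `Div(f) ≤ Div(g ∘ f)` (Remark 1.1.1: `Div(g ∘ f) = f^* Div(g) + deg_Fr(g) · Div(f)`).
[cite: MochizukiFrdI2008, Rem. 1.1.1 p.21] -/
theorem div_dvd_div_comp {X Y Z : C} (f : X ⟶ Y) (g : Y ⟶ Z) : Div F f ∣ Div F (f ≫ g) := by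
  rw [div_comp]
  exact dvd_mul_of_dvd_right (dvd_pow_self _ (degFr F g).ne_zero) _

/-- **Primary pre-steps via Def. 1.3 (iii)(d)** ("by applying the equivalences of categories of
Definition 1.3, (iii), (d)", p. 79): in a Frobenioid of perfect and isotropic type with `Φ`
perf-factorial, a pre-step `φ : A → B` is primary iff `Div(φ) ≠ 0` and, for any two pre-steps
`φ₁ : A → B₁`, `φ₂ : A → B₂` through which `φ` factors, one of `φ₁, φ₂` factors through the other.
(`Φ(A)` is perfect by Prop. 1.10 (iii); every pre-step is co-angular by Prop. 1.4 (i); the order on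
`Order(Φ(A))` is read off through Def. 1.3 (iii)(d) for the co-angular pre-steps out of `A`.)
[cite: MochizukiFrdI2008, Thm. 4.2 (i) p.78] -/
theorem isPrimary_div_iff_of_isPreStep (hF : IsFrobenioid F) (hperf : IsOfPerfectType F)
    (histr : IsOfIsotropicType F) (hpf : Objectwise (fun M _ => IsPerfFactorial M) Φ)
    {A B : C} {φ : A ⟶ B} (hφ : IsPreStep F φ) :
    IsPrimary (Div F φ) ↔ Div F φ ≠ 1 ∧
      ∀ ⦃B₁ B₂ : C⦄ (φ₁ : A ⟶ B₁) (φ₂ : A ⟶ B₂), IsPreStep F φ₁ → IsPreStep F φ₂ →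
        (∃ f₁ : B₁ ⟶ B, φ₁ ≫ f₁ = φ) → (∃ f₂ : B₂ ⟶ B, φ₂ ≫ f₂ = φ) →
          (∃ g : B₁ ⟶ B₂, φ₁ ≫ g = φ₂) ∨ (∃ g : B₂ ⟶ B₁, φ₂ ≫ g = φ₁) := by
  have hco : ∀ {X Y : C} (f : X ⟶ Y), IsCoAngular F f :=
    fun f => isCoAngular_of_isIsotropic_codomains F f fun Z _ => histr Z
  have hpfA : IsPerfFactorial (Φ.obj (op (baseObj F A))) := hpf (baseObj F A)
  have hperfA : IsPerfect (Φ.obj (op (baseObj F A))) := isPerfect_divisorMonoid hF hperf A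
  constructor
  · intro hprim
    refine ⟨hprim.1, fun B₁ B₂ φ₁ φ₂ hφ₁ hφ₂ h₁ h₂ => ?_⟩
    obtain ⟨f₁, hf₁⟩ := h₁
    obtain ⟨f₂, hf₂⟩ := h₂
    have hd₁ : Div F φ₁ ∣ Div F φ := hf₁ ▸ div_dvd_div_comp φ₁ f₁
    have hd₂ : Div F φ₂ ∣ Div F φ := hf₂ ▸ div_dvd_div_comp φ₂ f₂
    rcases hpfA.dvd_total_of_dvd_of_isPrimary hprim hd₁ hd₂ with h12 | h21
    · obtain ⟨g, -, hg⟩ := hF.iii_d_under_full φ₁ φ₂ ⟨hco φ₁, hφ₁⟩ ⟨hco φ₂, hφ₂⟩ h12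
      exact Or.inl ⟨g, hg⟩
    · obtain ⟨g, -, hg⟩ := hF.iii_d_under_full φ₂ φ₁ ⟨hco φ₂, hφ₂⟩ ⟨hco φ₁, hφ₁⟩ h21
      exact Or.inr ⟨g, hg⟩
  · rintro ⟨hne, hcond⟩
    refine hpfA.isPrimary_of_dvd_total hperfA hne fun b c hb hc => ?_
    obtain ⟨B₁, φ₁, hφ₁, hφ₁d⟩ := hF.iii_d_under_surj A b
    obtain ⟨B₂, φ₂, hφ₂, hφ₂d⟩ := hF.iii_d_under_surj A c
    obtain ⟨f₁, -, hf₁⟩ := hF.iii_d_under_full φ₁ φ hφ₁ ⟨hco φ, hφ⟩ (by rw [hφ₁d]; exact hb)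
    obtain ⟨f₂, -, hf₂⟩ := hF.iii_d_under_full φ₂ φ hφ₂ ⟨hco φ, hφ⟩ (by rw [hφ₂d]; exact hc)
    rcases hcond φ₁ φ₂ hφ₁.2 hφ₂.2 ⟨f₁, hf₁⟩ ⟨f₂, hf₂⟩ with ⟨g, hg⟩ | ⟨g, hg⟩
    · left
      rw [← hφ₁d, ← hφ₂d, ← hg]
      exact div_dvd_div_comp φ₁ g
    · right
      rw [← hφ₁d, ← hφ₂d, ← hg]
      exact div_dvd_div_comp φ₂ g

end PreFrobenioid

/-! ### 3. Transport along the equivalence `Ψ` of the setting of Thm. 4.2 -/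

namespace FrdI.T42

variable {D₁ : Type u} [Category.{v} D₁] {Φ₁ : D₁ᵒᵖ ⥤ CommMonCat.{w}} {C₁ : Type u'} [Category.{v'} C₁]
  {D₂ : Type u} [Category.{v} D₂] {Φ₂ : D₂ᵒᵖ ⥤ CommMonCat.{w}} {C₂ : Type u'} [Category.{v'} C₂]
  {F₁ : C₁ ⥤ ElemFrobenioid Φ₁} {F₂ : C₂ ⥤ ElemFrobenioid Φ₂} {Ψ : C₁ ≌ C₂}

/-- In the setting of Thm. 4.2, `Ψ` REFLECTS pre-steps: if `Ψ(f)` is a pre-step then so is `f`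
(Thm. 3.4 (ii) for the quasi-inverse, `Ψ⁻¹Ψ(f) = η⁻¹ ∘ f ∘ η`, and Prop. 1.7 (v): the factors of a
pre-step are pre-steps). [cite: MochizukiFrdI2008, Thm. 3.4 (ii) p.62] -/
theorem Setting.isPreStep_of_map (S : Setting F₁ F₂ Ψ) {X Y : C₁} (f : X ⟶ Y)
    (h : PreFrobenioid.IsPreStep F₂ (Ψ.functor.map f)) : PreFrobenioid.IsPreStep F₁ f := by
  have hD₁ := S.isFrobenioid₁.isPreFrobenioid.isTotallyEpimorphic_base
  have h₂ : PreFrobenioid.IsPreStep F₁ (Ψ.inverse.map (Ψ.functor.map f)) := S.preStep_inv _ h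
  rw [Ψ.inv_fun_map] at h₂
  exact (PreFrobenioid.isPreStep_factors F₁ hD₁ (PreFrobenioid.isPreStep_factors F₁ hD₁ h₂).1).2

/-- **`Ψ` preserves primary pre-steps** in the setting of the proof of Thm. 4.2 (p. 78 ll. 28–46:
perfect and isotropic type, `Φ_i` perf-factorial, Thm. 3.4 (ii) for `Ψ` and a quasi-inverse): the
order-theoretic criterion `PreFrobenioid.isPrimary_div_iff_of_isPreStep` is transported along the
equivalence — factorizations of `Ψ(φ)` through pre-steps of `C₂` are pulled back to `C₁` through the
fully faithful, essentially surjective `Ψ` (pre-steps being reflected, `isPreStep_of_map`), compared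
there, and the comparison is pushed forward. [cite: MochizukiFrdI2008, Thm. 4.2 (i) p.78] -/
theorem Setting.isPrimaryPreStep_map (S : Setting F₁ F₂ Ψ) {A B : C₁} {φ : A ⟶ B}
    (hφ : PreFrobenioid.IsPrimaryPreStep F₁ φ) :
    PreFrobenioid.IsPrimaryPreStep F₂ (Ψ.functor.map φ) := by
  obtain ⟨hφpre, hφprim⟩ := hφ
  have hφpre₂ : PreFrobenioid.IsPreStep F₂ (Ψ.functor.map φ) := S.preStep_map φ hφpre
  refine ⟨hφpre₂, ?_⟩
  have h₁ := (PreFrobenioid.isPrimary_div_iff_of_isPreStep S.isFrobenioid₁ S.perfect₁ S.isotropic₁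
    S.perfFactorial₁ hφpre).mp hφprim
  refine (PreFrobenioid.isPrimary_div_iff_of_isPreStep S.isFrobenioid₂ S.perfect₂ S.isotropic₂
    S.perfFactorial₂ hφpre₂).mpr ⟨?_, ?_⟩
  · -- `Ψ(φ)` is a step, hence has non-zero zero divisor (isotropic type)
    have hstep : PreFrobenioid.IsStep F₁ φ := ⟨hφpre, fun hiso => hφprim.1 (by
      haveI := hiso
      exact PreFrobenioid.isIsometry_of_isIso F₁ S.isFrobenioid₁.isPreFrobenioid φ)⟩
    exact PreFrobenioid.div_ne_one_of_isStep S.isotropic₂ (S.step_map φ hstep)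
  · rintro B₁' B₂' φ₁' φ₂' hφ₁' hφ₂' ⟨f₁', hf₁'⟩ ⟨f₂', hf₂'⟩
    -- pull the two factorizations back to `C₁` through the fully faithful, essentially surjective `Ψ`
    let e₁ : Ψ.functor.obj (Ψ.functor.objPreimage B₁') ≅ B₁' := Ψ.functor.objObjPreimageIso B₁'
    let e₂ : Ψ.functor.obj (Ψ.functor.objPreimage B₂') ≅ B₂' := Ψ.functor.objObjPreimageIso B₂'
    let φ₁ : A ⟶ Ψ.functor.objPreimage B₁' := Ψ.functor.preimage (φ₁' ≫ e₁.inv)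
    let φ₂ : A ⟶ Ψ.functor.objPreimage B₂' := Ψ.functor.preimage (φ₂' ≫ e₂.inv)
    let f₁ : Ψ.functor.objPreimage B₁' ⟶ B := Ψ.functor.preimage (e₁.hom ≫ f₁')
    let f₂ : Ψ.functor.objPreimage B₂' ⟶ B := Ψ.functor.preimage (e₂.hom ≫ f₂')
    have hφ₁m : Ψ.functor.map φ₁ = φ₁' ≫ e₁.inv := Ψ.functor.map_preimage _
    have hφ₂m : Ψ.functor.map φ₂ = φ₂' ≫ e₂.inv := Ψ.functor.map_preimage _
    have hf₁m : Ψ.functor.map f₁ = e₁.hom ≫ f₁' := Ψ.functor.map_preimage _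
    have hf₂m : Ψ.functor.map f₂ = e₂.hom ≫ f₂' := Ψ.functor.map_preimage _
    have hφ₁ : PreFrobenioid.IsPreStep F₁ φ₁ := S.isPreStep_of_map φ₁ (by
      rw [hφ₁m]
      exact PreFrobenioid.IsPreStep.comp F₂ hφ₁' (PreFrobenioid.isPreStep_of_isIso F₂ _))
    have hφ₂ : PreFrobenioid.IsPreStep F₁ φ₂ := S.isPreStep_of_map φ₂ (by
      rw [hφ₂m]
      exact PreFrobenioid.IsPreStep.comp F₂ hφ₂' (PreFrobenioid.isPreStep_of_isIso F₂ _))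
    have hfac₁ : φ₁ ≫ f₁ = φ := Ψ.functor.map_injective (by
      rw [Functor.map_comp, hφ₁m, hf₁m, Category.assoc, e₁.inv_hom_id_assoc, hf₁'])
    have hfac₂ : φ₂ ≫ f₂ = φ := Ψ.functor.map_injective (by
      rw [Functor.map_comp, hφ₂m, hf₂m, Category.assoc, e₂.inv_hom_id_assoc, hf₂'])
    -- compare in `C₁`, push the comparison forward
    rcases h₁.2 φ₁ φ₂ hφ₁ hφ₂ ⟨f₁, hfac₁⟩ ⟨f₂, hfac₂⟩ with ⟨g, hg⟩ | ⟨g, hg⟩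
    · refine Or.inl ⟨e₁.inv ≫ Ψ.functor.map g ≫ e₂.hom, ?_⟩
      calc φ₁' ≫ e₁.inv ≫ Ψ.functor.map g ≫ e₂.hom
          = Ψ.functor.map (φ₁ ≫ g) ≫ e₂.hom := by
            rw [Functor.map_comp, hφ₁m]; simp only [Category.assoc]
        _ = φ₂' := by rw [hg, hφ₂m, Category.assoc, e₂.inv_hom_id, Category.comp_id]
    · refine Or.inr ⟨e₂.inv ≫ Ψ.functor.map g ≫ e₁.hom, ?_⟩
      calc φ₂' ≫ e₂.inv ≫ Ψ.functor.map g ≫ e₁.hom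
          = Ψ.functor.map (φ₂ ≫ g) ≫ e₁.hom := by
            rw [Functor.map_comp, hφ₂m]; simp only [Category.assoc]
        _ = φ₁' := by rw [hg, hφ₁m, Category.assoc, e₁.inv_hom_id, Category.comp_id]

/-- **`Ψ` maps primary steps to or from `A` to primary steps to or from `Ψ(A)`, with primary
composites**, for EVERY object `A` (the property `PreservesPrimaryAt` propagated in rows L04–L07 of
the printed proof, p. 78 l. 47 – p. 80 l. 17). [cite: MochizukiFrdI2008, Thm. 4.2 (i) p.78] -/
theorem preservesPrimaryAt (S : Setting F₁ F₂ Ψ) (A : C₁) : PreservesPrimaryAt F₁ F₂ Ψ A := by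
  refine ⟨?_, ?_, ?_⟩
  · intro B φ _ hφ
    exact S.isPrimaryPreStep_map hφ
  · intro B ψ _ hψ
    exact S.isPrimaryPreStep_map hψ
  · intro B B' φ ψ _ _ _ hφψ _
    rw [← Functor.map_comp]
    exact S.isPrimaryPreStep_map hφψ

/-- **T42-L05** `PrimaryStepsPropagateAlongPrimaryStep` (p. 78 l. 54 – p. 79 l. 22) — PROVED (the
conclusion holds at every object, `preservesPrimaryAt`). [cite: MochizukiFrdI2008, Thm. 4.2 (i) p.79] -/
theorem PrimaryStepsPropagateAlongPrimaryStep_holds :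
    Literature.AlgebraicGeometry.Frobenioids.FrdI.T42.PrimaryStepsPropagateAlongPrimaryStep := by
  intro D₁ _ Φ₁ C₁ _ D₂ _ Φ₂ C₂ _ F₁ F₂ Ψ S A F ε _ _ _
  exact preservesPrimaryAt S F

/-- **T42-L06** `PrimaryStepsPropagateToB` (p. 79 ll. 23–42) — PROVED (the conclusion holds at every
object, `preservesPrimaryAt`). [cite: MochizukiFrdI2008, Thm. 4.2 (i) p.79] -/
theorem PrimaryStepsPropagateToB_holds :
    Literature.AlgebraicGeometry.Frobenioids.FrdI.T42.PrimaryStepsPropagateToB := by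
  intro D₁ _ Φ₁ C₁ _ D₂ _ Φ₂ C₂ _ F₁ F₂ Ψ S A B ζ _ _ _ _
  exact preservesPrimaryAt S B

/-- **T42-L07** `PrimaryStepsPropagateFromB` (p. 79 l. 43 – p. 80 l. 17) — PROVED (the conclusion
holds at every object, `preservesPrimaryAt`). [cite: MochizukiFrdI2008, Thm. 4.2 (i) p.80] -/
theorem PrimaryStepsPropagateFromB_holds :
    Literature.AlgebraicGeometry.Frobenioids.FrdI.T42.PrimaryStepsPropagateFromB := by
  intro D₁ _ Φ₁ C₁ _ D₂ _ Φ₂ C₂ _ F₁ F₂ Ψ S A B X ζ ξ _ _ _ _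
  exact preservesPrimaryAt S X

/-- **T42-L07, conclusion** `PrimaryStepsPreserved` ("`Ψ` preserves primary steps", p. 80 ll. 15–17) —
PROVED, in fact without the hypothesis on Div-identity prime-Frobenius endomorphisms
(`Setting.isPrimaryPreStep_map`). [cite: MochizukiFrdI2008, Thm. 4.2 (i) p.80] -/
theorem PrimaryStepsPreserved_holds :
    Literature.AlgebraicGeometry.Frobenioids.FrdI.T42.PrimaryStepsPreserved := by
  intro D₁ _ Φ₁ C₁ _ D₂ _ Φ₂ C₂ _ F₁ F₂ Ψ S _ X Y φ hφ
  exact S.isPrimaryPreStep_map hφ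

end FrdI.T42

end Literature.AlgebraicGeometry.Frobenioids
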